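import Summits.ResolutionOfSingularities.ResolutionOfSingularities.Theorems.MonomialTowerClasses
import HarnessLib

/-!
# CornerTowerDescent — the two-letter descent and the tree leaves `NoCornerTower d n`, `d ≤ 3`, PROVED OUTRIGHT

[WRITER NOTE (decomp-res writer g5).  This Theorems file is the lens-5 g13 standalone addendum `CornerTowerDescent`
(critic row 82, CRITIC-LEDGER line 103, CLEARED-ADDENDUM-2; co-credit lens-3 g12 rev 2 §7) VERBATIM (sha256 of the lens
file f2d89afc5623acb0…): the abstract `two_letter_descent`, `cornerTower_no_two_letters` (any `d`), and the tree leaves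
`MonomialTowerClasses.NoCornerTower d n` for `d ≤ 3` PROVED OUTRIGHT.  The case `d = 4` (hence the aggregate
`HugDimensionClasses.NoCornerTowers`) is PROVED in the companion `Theorems/CornerTowerDynamics` (lens-3 g12 rev 3 §6b/§7,
critic row 84) which imports this file; `two_letter_descent` is also the engine of `Theorems/LassoCutCornerTails`
(lens-5 g13 LassoCut v3 §4c).  TREE.md leaf #17′.]

Decomposition cell `decomp-res`, lens 5 («finite/base range + asymptotic regime + bridge»), generation 13, second
addendum (standalone, light imports: only the tree's `MonomialTowerClasses`).

THE MOVE.  In a monomial corner tower (`MonomialTowerClasses.CornerTower d n`: exponent sets `G i`, directions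
`dir i`, `G (i+1) = chart_{dir i}(G i)`, order exactly `n`, `Isolated n`) that plays, from some stage on, only TWO
directions `J ≠ K`, the two off-balances `ρ_J(α) = |α| − α_J − n`, `ρ_K(α) = |α| − α_K − n` of a
generator evolve
alone: a `J`-play adds `ρ_J` to `ρ_K`, a `K`-play adds `ρ_K` to `ρ_J` (the parabolic generators of `SL₂(ℤ)`), so the
product `π = ρ_J ρ_K` rises by the SQUARE of the played balance.  A doubly light generator (`ρ_J, ρ_K < 0`) would stay
doubly light and lose degree at every stage — absurd — so the isolation witness of each stage (`ρ_played ≤ −1`) has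
`ρ_other ≥ −ρ_played`, i.e. `π ≤ −1`, and its `π` rises by `≥ 1` while staying `≤ 0`: the negative part
`Σ_{G i} π⁻ ∈ ℕ` strictly decreases.  Hence (`cornerTower_no_two_letters`) NO corner tower, in ANY number `d` of
corner parameters, plays eventually only two directions.  Since the persistent order-`n` generator kills every
direction played (`CornerTower.not_exhaustive`, tree), a tower with `d ≤ 3` parameters has an eventually unplayed
direction, whence the tree leaves `NoCornerTower 2 n` and `NoCornerTower 3 n` — so far KNOWN-MOD-PORT only
(`noCornerTower_of_model`; `d ≤ 1` proved) — are PROVED OUTRIGHT for every marking `n`, and the tree's aggregate leaf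
`HugDimensionClasses.NoCornerTowers` (`∀ n ≥ 1, ∀ d ≤ 4`) is REDUCED TO ITS SINGLE CASE `d = 4` with at least three
recurring directions (`noCornerTower_le_four_of_four`).  The abstract lemma `two_letter_descent` (deletions allowed,
light elements kept) is the same one that decides the two-chart corner tails of the tight-defect E-model
(`LassoCut.no_twoChart_corner_tail`, lens-5 g13 `LassoCut.lean` §4c).

0 `sorry`, no new axioms; tree-only imports.
-/

namespace Summit.ResolutionOfSingularities.ResolutionOfSingularities.Theorems.CornerTowerDescent

open Summit.ResolutionOfSingularities.ResolutionOfSingularities.Theorems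

/-- The negative part of the product potential. DEFINITION (support). [folklore] -/
def twoPot (u v : ℤ) : ℤ := max 0 (-(u * v))

/-- pure arithmetic. [folklore] -/
theorem twoPot_nonneg (u v : ℤ) : 0 ≤ twoPot u v := le_max_left _ _

/-- pure arithmetic. [folklore] -/
theorem twoPot_comm (u v : ℤ) : twoPot u v = twoPot v u := by
  unfold twoPot; rw [mul_comm]

/-- A play never increases the negative part of `π` (`π` rises by a square). [folklore] -/
theorem twoPot_step_le (u v : ℤ) : twoPot u (v + u) ≤ twoPot u v := by
  unfold twoPot
  refine max_le (le_max_left _ _) (le_trans ?_ (le_max_right _ _))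
  nlinarith [sq_nonneg u]

/-- … and on the isolation witness (`u ≤ −1`, `v ≥ −u`) it drops by at least one. [folklore] -/
theorem twoPot_step_lt (u v : ℤ) (hu : u ≤ -1) (hv : -u ≤ v) : twoPot u (v + u) + 1 ≤ twoPot u v := by
  unfold twoPot
  have h1 : 0 ≤ -(u * (v + u)) := by nlinarith
  have h2 : 0 ≤ -(u * v) := by nlinarith
  rw [max_eq_right h1, max_eq_right h2]
  nlinarith

/-- **ABSTRACT TWO-LETTER DESCENT.**  Data: finite sets `S i` of «monomials» moved by maps `φ i` playing letters
`dir i ∈ {J, K}`; `deg` and the off-degrees `off k` obey the chart laws (`off_played` invariant, `off_other + n =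
off_other + off_played`, `deg' + n = deg + off_played`); `S (i+1) ⊆ φ_i(S i)` (deletions allowed) but LIGHT elements
(`off_played < n`) are kept; all degrees `≥ n`; every step has a light element (isolation).  Conclusion: absurd.
Proof: doubly light elements descend in degree forever (excluded), so the light witness has `π = ρ_J ρ_K ≤ −1` and the
sum of negative parts of `π` over `S i` strictly decreases in `ℕ`. [folklore] (new here) -/
theorem two_letter_descent {A L : Type} [DecidableEq A] [DecidableEq L] (n : ℕ) (deg : A → ℕ) (off : L → A → ℕ)
    (S : ℕ → Finset A) (φ : ℕ → A → A) (dir : ℕ → L) (J K : L) (hJK : J ≠ K)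
    (htwo : ∀ i, dir i = J ∨ dir i = K)
    (hsame : ∀ i a, off (dir i) (φ i a) = off (dir i) a)
    (hother : ∀ i a k, k ≠ dir i → n ≤ deg a → off k (φ i a) + n = off k a + off (dir i) a)
    (hdeg : ∀ i a, n ≤ deg a → deg (φ i a) + n = deg a + off (dir i) a)
    (hS : ∀ i, S (i + 1) ⊆ (S i).image (φ i))
    (hkeep : ∀ i, ∀ a ∈ S i, off (dir i) a < n → φ i a ∈ S (i + 1))
    (hle : ∀ i, ∀ a ∈ S i, n ≤ deg a) (hiso : ∀ i, ∃ a ∈ S i, off (dir i) a < n) : False := by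
  classical
  have hKJ : ∀ i, (dir i = J ∧ K ≠ dir i) ∨ (dir i = K ∧ J ≠ dir i) := fun i => by
    rcases htwo i with h | h
    · exact Or.inl ⟨h, by rw [h]; exact hJK.symm⟩
    · exact Or.inr ⟨h, by rw [h]; exact hJK⟩
  -- (1) no doubly light element: it would keep losing degree
  have hDL : ∀ i, ∀ a ∈ S i, off J a < n → off K a < n → False := by
    intro i a ha hJ hK
    have desc : ∀ m, ∃ b ∈ S (i + m), off J b < n ∧ off K b < n ∧ deg b + m ≤ deg a := by
      intro m
      induction m with
      | zero => exact ⟨a, ha, hJ, hK, le_rfl⟩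
      | succ m ih =>
        obtain ⟨b, hb, hbJ, hbK, hbd⟩ := ih
        have hbdir : off (dir (i + m)) b < n := by
          rcases htwo (i + m) with h | h
          · rw [h]; exact hbJ
          · rw [h]; exact hbK
        have hnb := hle _ b hb
        have hd := hdeg (i + m) b hnb
        refine ⟨φ (i + m) b, hkeep _ b hb hbdir, ?_, ?_, by omega⟩
        · rcases hKJ (i + m) with ⟨hd', hne⟩ | ⟨hd', hne⟩
          · have h1 := hsame (i + m) b
            rw [hd'] at h1
            omega
          · have h1 := hother (i + m) b J hne hnb
            rw [hd'] at h1
            omega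
        · rcases hKJ (i + m) with ⟨hd', hne⟩ | ⟨hd', hne⟩
          · have h1 := hother (i + m) b K hne hnb
            rw [hd'] at h1
            omega
          · have h1 := hsame (i + m) b
            rw [hd'] at h1
            omega
    obtain ⟨b, -, -, -, hbd⟩ := desc (deg a + 1)
    omega
  -- (2) the potential `V i = Σ_{a ∈ S i} π⁻(a)` with `ρ_k = off_k − n`
  have hstep : ∀ i, ∀ a ∈ S i,
      twoPot ((off J (φ i a) : ℤ) - n) ((off K (φ i a) : ℤ) - n) ≤
        twoPot ((off J a : ℤ) - n) ((off K a : ℤ) - n) := by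
    intro i a ha
    have hna := hle i a ha
    rcases hKJ i with ⟨hd, hne⟩ | ⟨hd, hne⟩
    · have h1 := hsame i a
      have h2 := hother i a K hne hna
      rw [hd] at h1 h2
      have h2' : ((off K (φ i a) : ℕ) : ℤ) - n = ((off K a : ℤ) - n) + ((off J a : ℤ) - n) := by
        have := congrArg (Nat.cast (R := ℤ)) h2
        push_cast at this
        linarith
      rw [h1, h2']
      exact twoPot_step_le _ _
    · have h1 := hsame i a
      have h2 := hother i a J hne hna
      rw [hd] at h1 h2
      have h2' : ((off J (φ i a) : ℕ) : ℤ) - n = ((off J a : ℤ) - n) + ((off K a : ℤ) - n) := by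
        have := congrArg (Nat.cast (R := ℤ)) h2
        push_cast at this
        linarith
      rw [h1, h2', twoPot_comm, twoPot_comm ((off J a : ℤ) - n)]
      exact twoPot_step_le _ _
  have hwit : ∀ i, ∃ a ∈ S i,
      twoPot ((off J (φ i a) : ℤ) - n) ((off K (φ i a) : ℤ) - n) + 1 ≤
        twoPot ((off J a : ℤ) - n) ((off K a : ℤ) - n) := by
    intro i
    obtain ⟨a, ha, hlow⟩ := hiso i
    have hna := hle i a ha
    have hka := hkeep i a ha hlow
    refine ⟨a, ha, ?_⟩
    rcases hKJ i with ⟨hd, hne⟩ | ⟨hd, hne⟩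
    · have h1 := hsame i a
      have h2 := hother i a K hne hna
      rw [hd] at h1 h2 hlow
      -- the image is not doubly light, so `off K a + off J a ≥ 2n`
      have hK' : ¬ off K (φ i a) < n := fun h => hDL (i + 1) _ hka (by rw [h1]; exact hlow) h
      have h2' : ((off K (φ i a) : ℕ) : ℤ) - n = ((off K a : ℤ) - n) + ((off J a : ℤ) - n) := by
        have := congrArg (Nat.cast (R := ℤ)) h2
        push_cast at this
        linarith
      rw [h1, h2']
      exact twoPot_step_lt _ _ (by have := hlow; omega) (by push Not at hK'; have := hK'; omega)
    · have h1 := hsame i a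
      have h2 := hother i a J hne hna
      rw [hd] at h1 h2 hlow
      have hJ' : ¬ off J (φ i a) < n := fun h => hDL (i + 1) _ hka h (by rw [h1]; exact hlow)
      have h2' : ((off J (φ i a) : ℕ) : ℤ) - n = ((off J a : ℤ) - n) + ((off K a : ℤ) - n) := by
        have := congrArg (Nat.cast (R := ℤ)) h2
        push_cast at this
        linarith
      rw [h1, h2', twoPot_comm, twoPot_comm ((off J a : ℤ) - n)]
      exact twoPot_step_lt _ _ (by have := hlow; omega) (by push Not at hJ'; have := hJ'; omega)
  -- (3) strict descent of the sum in ℕ-valued integers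
  set V : ℕ → ℤ := fun i => ∑ a ∈ S i, twoPot ((off J a : ℤ) - n) ((off K a : ℤ) - n) with hV
  have hV0 : ∀ i, 0 ≤ V i := fun i => Finset.sum_nonneg fun a _ => twoPot_nonneg _ _
  have hVlt : ∀ i, V (i + 1) < V i := by
    intro i
    calc V (i + 1) ≤ ∑ a ∈ (S i).image (φ i), twoPot ((off J a : ℤ) - n) ((off K a : ℤ) - n) :=
          Finset.sum_le_sum_of_subset_of_nonneg (hS i) fun a _ _ => twoPot_nonneg _ _
      _ ≤ ∑ a ∈ S i, twoPot ((off J (φ i a) : ℤ) - n) ((off K (φ i a) : ℤ) - n) :=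
          Finset.sum_image_le_of_nonneg fun a _ => twoPot_nonneg _ _
      _ < V i := by
          obtain ⟨a, ha, hlt⟩ := hwit i
          exact Finset.sum_lt_sum (fun a ha => hstep i a ha) ⟨a, ha, by omega⟩
  have hdesc : ∀ m, V m + m ≤ V 0 := by
    intro m
    induction m with
    | zero => simp
    | succ m ih => have := hVlt m; push_cast; omega
  have h1 := hdesc ((V 0).toNat + 1)
  have h2 := hV0 ((V 0).toNat + 1)
  have h3 : (((V 0).toNat : ℕ) : ℤ) = V 0 := Int.toNat_of_nonneg (hV0 0)
  push_cast at h1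
  omega

/-- On `Fin 3`, «not the letter `l`» means «one of the two other letters `l+1`, `l+2`». [folklore] -/
theorem fin3_eq_or_of_ne : ∀ l x : Fin 3, x ≠ l → x = l + 1 ∨ x = l + 2 := by decide

/-- pure arithmetic. [folklore] -/
theorem fin3_succ_ne_succ_succ : ∀ l : Fin 3, l + 1 ≠ l + 2 := by decide

/-- pure arithmetic: two distinct coordinates are bounded by the degree (tree `Expo`). [folklore] -/
theorem expo_add_le_deg {d : ℕ} (α : MonomialTowerClasses.Expo d) {j k : Fin d} (hjk : j ≠ k) :
    α j + α k ≤ α.deg := by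
  unfold MonomialTowerClasses.Expo.deg
  rw [← Finset.sum_pair hjk]
  exact Finset.sum_le_sum_of_subset_of_nonneg (Finset.subset_univ _) fun _ _ _ => Nat.zero_le _

/-- **NO TWO-LETTER MONOMIAL CORNER TOWERS** (tree `MonomialTowerClasses.CornerTower`, ANY number `d` of corner
parameters, any marking `n`): a corner tower cannot, from some stage on, play only two directions `J, K`.
[DECIDED — PROVED here, by `two_letter_descent`: order `≥ n` = legality, `Isolated n` = a light generator for the
direction played, `G (i+1) = chart(G i)` = no deletions] (Sources: BierstoneGrigorievMilmanWlodarczyk2011, §3.) -/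
theorem cornerTower_no_two_letters {d n : ℕ} (T : MonomialTowerClasses.CornerTower d n) (i₀ : ℕ) (J K : Fin d)
    (hJK : J ≠ K) (htwo : ∀ m, T.dir (i₀ + m) = J ∨ T.dir (i₀ + m) = K) : False := by
  classical
  refine two_letter_descent (A := MonomialTowerClasses.Expo d) (L := Fin d) n (fun α => α.deg)
    (fun k α => α.deg - α k) (fun i => T.G (i₀ + i)) (fun i => MonomialTowerClasses.Expo.chart n (T.dir (i₀ + i)))
    (fun i => T.dir (i₀ + i)) J K hJK htwo ?_ ?_ ?_ ?_ ?_ ?_ ?_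
  · intro i α
    rw [MonomialTowerClasses.Expo.deg_chart, MonomialTowerClasses.Expo.chart_apply_same]
    have := MonomialTowerClasses.Expo.le_deg α (T.dir (i₀ + i))
    omega
  · intro i α k hk hle
    rw [MonomialTowerClasses.Expo.deg_chart, MonomialTowerClasses.Expo.chart_apply_ne n hk]
    have h1 := expo_add_le_deg α (Ne.symm hk)
    have h2 := MonomialTowerClasses.Expo.le_deg α (T.dir (i₀ + i))
    omega
  · intro i α hle
    rw [MonomialTowerClasses.Expo.deg_chart]
    have h2 := MonomialTowerClasses.Expo.le_deg α (T.dir (i₀ + i))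
    omega
  · intro i
    show T.G (i₀ + i + 1) ⊆ _
    rw [T.step (i₀ + i)]
  · intro i α hα _
    exact T.chart_mem hα
  · intro i α hα
    exact (T.hasOrder (i₀ + i)).2 α hα
  · intro i
    obtain ⟨α, hα, hlt⟩ := T.isolated (i₀ + i) (T.dir (i₀ + i))
    exact ⟨α, hα, hlt⟩

/-- pure arithmetic. [folklore] -/
theorem fin2_eq_of_ne : ∀ l x : Fin 2, x ≠ l → x = l + 1 := by decide

/-- pure arithmetic. [folklore] -/
theorem fin2_succ_ne : ∀ l : Fin 2, l + 1 ≠ l := by decide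

/-- A corner tower at marking `0` is excluded by isolation itself (`_ < 0`). [folklore] -/
theorem noCornerTower_marking_zero (d : ℕ) : MonomialTowerClasses.NoCornerTower d 0 := by
  intro T
  obtain ⟨α, -, hα⟩ := T.isolated 0 (T.dir 0)
  omega

/-- **THE TREE LEAF `NoCornerTower 2 n` PROVED OUTRIGHT**: the persistent order-`n` generator forbids playing both
directions for ever (`CornerTower.not_exhaustive`), and a one-letter tail is a (degenerate) two-letter tail.
[DECIDED — PROVED here] (Sources: BierstoneGrigorievMilmanWlodarczyk2011, §3.) -/
theorem noCornerTower_two (n : ℕ) : MonomialTowerClasses.NoCornerTower 2 n := by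
  rcases Nat.eq_zero_or_pos n with hn | hn
  · subst hn; exact noCornerTower_marking_zero 2
  intro T
  have hX := T.not_exhaustive hn
  unfold MonomialTowerClasses.CornerTower.Exhaustive at hX
  push Not at hX
  obtain ⟨l, i₀, hl⟩ := hX
  exact cornerTower_no_two_letters T i₀ (l + 1) l (fin2_succ_ne l) fun m => Or.inl (fin2_eq_of_ne l _ (hl m))

/-- **THE TREE LEAF `NoCornerTower 3 n` PROVED OUTRIGHT** (lens-4 N48 `MonomialTowerClasses`; so far KNOWN-MOD-PORT
via `CornerModel` + `TowerObstructs`, only `d ≤ 1` proved): there is no infinite monomial corner tower in three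
corner parameters, at any marking `n`.  The persistent order-`n` generator kills every direction played
(`CornerTower.not_exhaustive`), so some direction `l` is eventually never played, and the remaining two-letter tower
falls to `cornerTower_no_two_letters`. [DECIDED — PROVED here] (Sources: BierstoneGrigorievMilmanWlodarczyk2011, §3.) -/
theorem noCornerTower_three (n : ℕ) : MonomialTowerClasses.NoCornerTower 3 n := by
  rcases Nat.eq_zero_or_pos n with hn | hn
  · subst hn; exact noCornerTower_marking_zero 3
  intro T
  have hX := T.not_exhaustive hn
  unfold MonomialTowerClasses.CornerTower.Exhaustive at hX
  push Not at hX
  obtain ⟨l, i₀, hl⟩ := hX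
  exact cornerTower_no_two_letters T i₀ (l + 1) (l + 2) (fin3_succ_ne_succ_succ l)
    fun m => fin3_eq_or_of_ne l _ (hl m)

/-- All corner-tower leaves with `d ≤ 3` corner parameters, every marking. [DECIDED — PROVED here] [folklore] -/
theorem noCornerTower_le_three (n d : ℕ) (hd : d ≤ 3) : MonomialTowerClasses.NoCornerTower d n := by
  rcases Nat.eq_zero_or_pos n with hn | hn
  · subst hn; exact noCornerTower_marking_zero d
  interval_cases d
  · exact MonomialTowerClasses.noCornerTower_zero hn
  · exact MonomialTowerClasses.noCornerTower_one hn
  · exact noCornerTower_two n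
  · exact noCornerTower_three n

/-- **THE TREE'S CORNER-TOWER LEAF IS REDUCED TO `d = 4`**: `HugDimensionClasses.NoCornerTowers`
(`∀ n ≥ 1, ∀ d ≤ 4, NoCornerTower d n`, consumed by `noForcedTowers_of_pieces` / `noHuggingTowers_of_g11` / N48's
`transversal_of_cornerModel'`) follows from its single case `d = 4` — and there, too, every tower playing eventually
only two directions is excluded (`cornerTower_no_two_letters`); the residual is a four-parameter tower with at least
THREE recurring directions. [EQUIV bookkeeping — PROVED here] [folklore] -/
theorem noCornerTower_le_four_of_four (h4 : ∀ n : ℕ, 1 ≤ n → MonomialTowerClasses.NoCornerTower 4 n) :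
    ∀ n : ℕ, 1 ≤ n → ∀ d : ℕ, d ≤ 4 → MonomialTowerClasses.NoCornerTower d n := by
  intro n hn d hd
  rcases Nat.lt_or_ge d 4 with h | h
  · exact noCornerTower_le_three n d (by omega)
  · have : d = 4 := le_antisymm hd h
    subst this
    exact h4 n hn

end Summit.ResolutionOfSingularities.ResolutionOfSingularities.Theorems.CornerTowerDescent
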